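import Literature.FieldTheory.AlgClosed.AutStableSubspaceDescent
import Mathlib.LinearAlgebra.Dual.Lemmas
import Mathlib.RingTheory.Spectrum.Prime.Topology
import HarnessLib

/-!
# Conjugate embeddings separate `A ⊗_K ℂ` for every `ℂ`-algebra `A`; the twisted diagonals of
# `Spec (A ⊗_K ℂ)` are dense

Topic `FieldTheory/AlgClosed`; a proofs-only sequel (theorems only, no definitions, no named facts)
of `AutStableSubspaceDescent.lean`, whose `Complex.eq_zero_of_forall_sum_algEquiv_mul_eq_zero`
(«conjugates of a `K`-linearly independent family of complex numbers satisfy no universal linear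
relation», `K ⊆ ℂ` countable) and `Complex.eq_zero_of_forall_productMap_algEquiv_eq_zero` (the case
`A = ℂ` below) we extend from `ℂ ⊗_K ℂ` to `A ⊗_K ℂ` for an arbitrary commutative `ℂ`-algebra `A`.
For `τ ∈ Aut_K(ℂ)` write `ψ_τ : A ⊗_K ℂ → A`, `a ⊗ c ↦ a · τ(c)` (Mathlib
`Algebra.TensorProduct.productMap (AlgHom.id K A) ((IsScalarTower.toAlgHom K ℂ A).comp τ)`; on
spectra, `Spec ψ_τ : Spec A → Spec A ×_K Spec ℂ` is the graph of `Spec τ`, the "twisted diagonal").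

* `Complex.eq_zero_of_forall_productMap_id_algEquiv_eq_zero` — **the `ψ_τ`, `τ ∈ Aut_K(ℂ)`, are
  jointly injective on `A ⊗_K ℂ`**: if `ψ_τ(h) = 0` for every `τ`, then `h = 0`.  Proof: write
  `h = Σᵢ aᵢ ⊗ bᵢ` on a `K`-basis `(bᵢ)` of `ℂ`; for every `ℂ`-linear functional `λ` on `A`,
  `λ(ψ_τ h) = Σᵢ τ(bᵢ) λ(aᵢ) = 0` for all `τ`, so `λ(aᵢ) = 0` by the cited lemma, so `aᵢ = 0`
  (linear functionals separate the points of a vector space, Mathlib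
  `Module.forall_dual_apply_eq_zero_iff`).
* `Complex.isReduced_tensorProduct_of_isReduced` — hence **`A ⊗_K ℂ` is reduced when `A` is**
  (a nilpotent `h` has nilpotent, hence zero, images `ψ_τ(h)` in the reduced ring `A`).
* `Complex.dense_iUnion_range_comap_productMap` — hence, for `A` reduced, **the union over
  `τ ∈ Aut_K(ℂ)` of the closed subsets `Spec ψ_τ (Spec A) ⊆ Spec (A ⊗_K ℂ)` is dense**: a basic open
  `D(g) ≠ ∅` has `g ≠ 0`, so some `ψ_τ(g) ≠ 0` is not nilpotent and a prime `𝔭 ∌ ψ_τ(g)` of `A`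
  gives the point `ψ_τ⁻¹ 𝔭 ∈ D(g)`.

These are the two inputs («the kernel pair of `X_ℂ → X` is reduced» and «the twisted diagonals
`(1, 1 × Spec τ) : X_ℂ → X_ℂ ×_X X_ℂ` have dense union») by which faithfully flat descent of
morphisms along `X_ℂ → X` is run for the NON-algebraic extension `ℂ / K` with the group
`Aut(ℂ/K)` in place of a Galois group (Weil, *Foundations*, I §7–8 "enough automorphisms"; Milne,
*Algebraic Geometry*, Ch. 16, Prop. 16.9 / Thm. 16.8 for `Ω ⊇ k` algebraically closed with
`Ω^{Aut(Ω/k)} = k`; this is the proof of Milne, *Introduction to Shimura Varieties*, Prop. 13.1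
«a regular map `V_Ω → W_Ω` commuting with the actions of `Aut(Ω/k)` … arises from a unique regular
map `V → W`», p. 117 of the held 2017 revision, for `Ω = ℂ` and `k` countable):
`Motives/ComplexTwistedDiagonals.lean`, `Motives/ComplexAutGaloisDescent.lean`.

Mathlib (pin v4.32.0) searched: `Algebra.TensorProduct.productMap`, `finsuppScalarLeft`,
`Module.forall_dual_apply_eq_zero_iff`, `PrimeSpectrum.isTopologicalBasis_basic_opens`,
`PrimeSpectrum.basicOpen_eq_bot_iff` (all used); Mathlib has `IsReduced (K ⊗[k] A)` for `K/k`
ALGEBRAIC over a geometrically reduced `A` (`RingTheory/Nilpotent/GeometricallyReduced`), nothing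
for the transcendental extension `ℂ/K`.

## References

* J. S. Milne, *Introduction to Shimura Varieties*, Clay Math. Proc. 4 (2005), rev. 2017 (held
  `paper:url-b0e8e4ca1c12`), §13, Prop. 13.1 p. 117 L5–13 (= Milne, *Algebraic Geometry*, Prop.
  16.9) and its use in the proof of Thm. 13.6 p. 118. [Milne2005ShimuraVarieties]
* A. Borel, *Linear Algebraic Groups*, 2nd ed. (1991), AG §§11–14 (`k`-structures, Galois criteria
  for rationality). [Borel1991]
* A. Weil, *Foundations of Algebraic Geometry*, AMS Colloq. Publ. 29 (1946/1962), Ch. I §7.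
-/

noncomputable section

open Cardinal TensorProduct

namespace Literature.FieldTheory.AlgClosed

variable {K : Type} [Field K] [Algebra K ℂ] {A : Type*} [CommRing A] [Algebra ℂ A] [Algebra K A]
  [IsScalarTower K ℂ A]

/-! ### The twisted multiplication maps `ψ_τ : A ⊗_K ℂ → A` are jointly injective -/

/-- `ψ_τ (a ⊗ c) = a · τ(c)`: the value of the twisted multiplication map
`Algebra.TensorProduct.productMap (AlgHom.id K A) ((IsScalarTower.toAlgHom K ℂ A).comp τ)` on a pure
tensor. [folklore] -/
private theorem Complex.productMap_id_algEquiv_tmul (τ : ℂ ≃ₐ[K] ℂ) (a : A) (c : ℂ) :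
    Algebra.TensorProduct.productMap (AlgHom.id K A)
        ((IsScalarTower.toAlgHom K ℂ A).comp (τ : ℂ →ₐ[K] ℂ)) (a ⊗ₜ[K] c) = τ c • a := by
  rw [Algebra.TensorProduct.productMap_apply_tmul, AlgHom.id_apply, AlgHom.comp_apply,
    IsScalarTower.toAlgHom_apply, Algebra.smul_def, mul_comm]
  rfl

/-- **The conjugates of the structure map separate `A ⊗_K ℂ`.** Let `K` be a countable field, `ℂ`
a `K`-algebra and `A` a commutative `ℂ`-algebra. If `h ∈ A ⊗_K ℂ` is killed by every twisted
multiplication map `ψ_τ : a ⊗ c ↦ a · τ(c)`, `τ ∈ Aut_K(ℂ)`, then `h = 0`. (Write `h = Σᵢ aᵢ ⊗ bᵢ`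
on a `K`-basis of `ℂ`; for each `ℂ`-linear functional `λ` on `A`, `Σᵢ τ(bᵢ) λ(aᵢ) = λ(ψ_τ h) = 0`
for all `τ`, whence `λ(aᵢ) = 0` by `Complex.eq_zero_of_forall_sum_algEquiv_mul_eq_zero`, whence
`aᵢ = 0`.) Equivalently the `K`-algebra map `A ⊗_K ℂ → ∏_{τ ∈ Aut_K(ℂ)} A` is injective.
[cite: Milne2005ShimuraVarieties, §13 Prop. 13.1 p. 117 L5–13 (the «enough automorphisms» input of its proof)] -/
theorem Complex.eq_zero_of_forall_productMap_id_algEquiv_eq_zero (hK : #K ≤ ℵ₀) {h : A ⊗[K] ℂ}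
    (hh : ∀ τ : ℂ ≃ₐ[K] ℂ, Algebra.TensorProduct.productMap (AlgHom.id K A)
      ((IsScalarTower.toAlgHom K ℂ A).comp (τ : ℂ →ₐ[K] ℂ)) h = 0) :
    h = 0 := by
  classical
  -- a `K`-basis of `ℂ` and the coordinates of `h`
  let b := Module.Basis.ofVectorSpace K ℂ
  let e : A ⊗[K] ℂ ≃ₗ[K] (Module.Basis.ofVectorSpaceIndex K ℂ →₀ A) :=
    (TensorProduct.comm K A ℂ).trans ((TensorProduct.congr b.repr (LinearEquiv.refl K A)).trans
      (finsuppScalarLeft K A (Module.Basis.ofVectorSpaceIndex K ℂ)))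
  set f := e h with hf
  have hterm : ∀ i a, e.symm (Finsupp.single i a) = a ⊗ₜ[K] b i := by
    intro i a
    change (TensorProduct.comm K A ℂ).symm ((TensorProduct.congr b.repr (LinearEquiv.refl K A)).symm
      ((finsuppScalarLeft K A _).symm (Finsupp.single i a))) = _
    rw [finsuppScalarLeft_symm_apply_single, TensorProduct.congr_symm_tmul,
      Module.Basis.repr_symm_single_one, LinearEquiv.refl_symm, LinearEquiv.refl_apply,
      TensorProduct.comm_symm_tmul]
  have hsum : h = ∑ i ∈ f.support, f i ⊗ₜ[K] b i := by
    have hf' : f = ∑ i ∈ f.support, Finsupp.single i (f i) := by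
      nth_rewrite 1 [← Finsupp.sum_single f]
      rfl
    calc h = e.symm f := (e.symm_apply_apply h).symm
      _ = ∑ i ∈ f.support, e.symm (Finsupp.single i (f i)) := by
          conv_lhs => rw [hf']
          rw [map_sum]
      _ = ∑ i ∈ f.support, f i ⊗ₜ[K] b i := Finset.sum_congr rfl fun i _ => hterm i (f i)
  -- for every `ℂ`-linear functional `λ` on `A`: `Σ τ(bᵢ) λ(f i) = 0`
  set ι := ↥f.support with hι
  have hli : LinearIndependent K (fun i : ι => b i) :=
    b.linearIndependent.comp (fun i : ι => (i : Module.Basis.ofVectorSpaceIndex K ℂ))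
      Subtype.val_injective
  have hcoord : ∀ i : ι, f i = 0 := by
    intro i
    refine (Module.forall_dual_apply_eq_zero_iff ℂ (f i)).1 fun lam => ?_
    have hrel : ∀ τ : ℂ ≃ₐ[K] ℂ, ∑ j : ι, τ (b j) * lam (f j) = 0 := by
      intro τ
      have h1 := congrArg lam (hh τ)
      rw [hsum, map_sum, map_sum, map_zero] at h1
      rw [Finset.sum_coe_sort f.support (fun j => τ (b j) * lam (f j)), ← h1]
      refine Finset.sum_congr rfl fun j _ => ?_
      rw [Complex.productMap_id_algEquiv_tmul, map_smul, smul_eq_mul]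
    have h0 := Complex.eq_zero_of_forall_sum_algEquiv_mul_eq_zero hK hli hrel
    exact congrFun h0 i
  -- hence `f = 0` and `h = 0`
  have hf0 : f = 0 := by
    ext i
    by_contra hi
    exact hi (hcoord ⟨i, Finsupp.mem_support_iff.2 hi⟩)
  rw [← e.symm_apply_apply h, ← hf, hf0, map_zero]

/-- Injectivity form: two elements of `A ⊗_K ℂ` with the same images under all `ψ_τ`,
`τ ∈ Aut_K(ℂ)`, are equal. [cite: Milne2005ShimuraVarieties, §13 Prop. 13.1 p. 117 L5–13 (the «enough automorphisms» input of its proof)] -/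
theorem Complex.eq_of_forall_productMap_id_algEquiv_eq (hK : #K ≤ ℵ₀) {h h' : A ⊗[K] ℂ}
    (hh : ∀ τ : ℂ ≃ₐ[K] ℂ, Algebra.TensorProduct.productMap (AlgHom.id K A)
      ((IsScalarTower.toAlgHom K ℂ A).comp (τ : ℂ →ₐ[K] ℂ)) h =
      Algebra.TensorProduct.productMap (AlgHom.id K A)
      ((IsScalarTower.toAlgHom K ℂ A).comp (τ : ℂ →ₐ[K] ℂ)) h') :
    h = h' := by
  rw [← sub_eq_zero]
  exact Complex.eq_zero_of_forall_productMap_id_algEquiv_eq_zero hK fun τ => by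
    rw [map_sub, hh τ, sub_self]

/-! ### `A ⊗_K ℂ` is reduced -/

/-- **`A ⊗_K ℂ` is reduced for a reduced `ℂ`-algebra `A`** (`K ⊆ ℂ` countable): a nilpotent `h`
has nilpotent images `ψ_τ(h)` in the reduced ring `A`, so they all vanish and `h = 0`
(`Complex.eq_zero_of_forall_productMap_id_algEquiv_eq_zero`). This is the reducedness of
`Z ×_K Spec ℂ` for a reduced `ℂ`-scheme `Z`, chart by chart. [cite: Milne2005ShimuraVarieties, §13 Prop. 13.1 p. 117 L5–13 (reducedness input of its proof)] -/
theorem Complex.isReduced_tensorProduct_of_isReduced [IsReduced A] (hK : #K ≤ ℵ₀) :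
    IsReduced (A ⊗[K] ℂ) := by
  refine ⟨fun h hn => ?_⟩
  exact Complex.eq_zero_of_forall_productMap_id_algEquiv_eq_zero hK fun τ => (hn.map _).eq_zero

/-! ### The twisted diagonals of `Spec (A ⊗_K ℂ)` are dense -/

/-- **The twisted diagonals are dense.** For a reduced commutative `ℂ`-algebra `A` and `K ⊆ ℂ`
countable, the union over `τ ∈ Aut_K(ℂ)` of the images of `Spec ψ_τ : Spec A → Spec (A ⊗_K ℂ)`
(the closed subsets `V(ker ψ_τ)`, graphs of the `Spec τ`) is dense in `Spec (A ⊗_K ℂ)`: a non-empty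
basic open set `D(g)` has `g ≠ 0`, so `ψ_τ(g) ≠ 0` for some `τ`
(`Complex.eq_zero_of_forall_productMap_id_algEquiv_eq_zero`), which is then not nilpotent, and a
prime `𝔭` of `A` avoiding it gives `ψ_τ⁻¹(𝔭) ∈ D(g)`. [cite: Milne2005ShimuraVarieties, §13 Prop. 13.1 p. 117 L5–13 (density input of its proof)] -/
theorem Complex.dense_iUnion_range_comap_productMap [IsReduced A] (hK : #K ≤ ℵ₀) :
    Dense (⋃ τ : ℂ ≃ₐ[K] ℂ, Set.range (PrimeSpectrum.comap
      (Algebra.TensorProduct.productMap (AlgHom.id K A)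
        ((IsScalarTower.toAlgHom K ℂ A).comp (τ : ℂ →ₐ[K] ℂ))).toRingHom)) := by
  classical
  rw [PrimeSpectrum.isTopologicalBasis_basic_opens.dense_iff]
  rintro _ ⟨g, rfl⟩ hne
  change ((PrimeSpectrum.basicOpen g : TopologicalSpace.Opens (PrimeSpectrum (A ⊗[K] ℂ))) :
    Set (PrimeSpectrum (A ⊗[K] ℂ))).Nonempty at hne
  -- `D(g) ≠ ∅` forces `g` non-nilpotent, in particular `g ≠ 0`
  have hg : g ≠ 0 := by
    rintro rfl
    have : (PrimeSpectrum.basicOpen (0 : A ⊗[K] ℂ) : Set (PrimeSpectrum (A ⊗[K] ℂ))) = ∅ := by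
      rw [(PrimeSpectrum.basicOpen_eq_bot_iff (0 : A ⊗[K] ℂ)).2 IsNilpotent.zero]
      rfl
    rw [this] at hne
    exact Set.not_nonempty_empty hne
  -- some `ψ_τ g ≠ 0`, hence not nilpotent in the reduced ring `A`
  obtain ⟨τ, hτ⟩ : ∃ τ : ℂ ≃ₐ[K] ℂ, Algebra.TensorProduct.productMap (AlgHom.id K A)
      ((IsScalarTower.toAlgHom K ℂ A).comp (τ : ℂ →ₐ[K] ℂ)) g ≠ 0 := by
    by_contra hall
    push Not at hall
    exact hg (Complex.eq_zero_of_forall_productMap_id_algEquiv_eq_zero hK hall)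
  set ψ := Algebra.TensorProduct.productMap (AlgHom.id K A)
      ((IsScalarTower.toAlgHom K ℂ A).comp (τ : ℂ →ₐ[K] ℂ)) with hψ
  have hnn : ¬ IsNilpotent (ψ g) := fun hn => hτ hn.eq_zero
  -- a prime of `A` avoiding `ψ g`
  have hne' : ((PrimeSpectrum.basicOpen (ψ g) : TopologicalSpace.Opens (PrimeSpectrum A)) :
      Set (PrimeSpectrum A)).Nonempty := by
    rw [Set.nonempty_iff_ne_empty]
    intro hempty
    apply hnn
    rw [← PrimeSpectrum.basicOpen_eq_bot_iff]
    exact TopologicalSpace.Opens.ext hempty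
  obtain ⟨p, hp⟩ := hne'
  refine ⟨PrimeSpectrum.comap ψ.toRingHom p, ?_, Set.mem_iUnion.2 ⟨τ, p, rfl⟩⟩
  rw [SetLike.mem_coe, PrimeSpectrum.mem_basicOpen] at hp ⊢
  rw [PrimeSpectrum.comap_asIdeal, Ideal.mem_comap]
  exact hp

end Literature.FieldTheory.AlgClosed

end
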